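import Mathlib

/-!
# `SnSubsetDichotomy.PolynomialSlack`, line `transport-split-hull` — stub `eventually_le_of_min_le`

The real-analysis skeleton of the induction on `n` behind the polynomial-slack thesis
(crux `stmt-MatrixMultiplication-8306`, registered stub `eventually_le_of_min_le` of
`Cruxes/PolynomialSlack/Lines/transport-split-hull.lean`).  For `Q n := (n!)^{3/2} / P(n)` (with
`P(n)` the maximal volume of a TPP triple in `S_n`) the combinatorics gives, for `n ≥ n₁`,
`Q n ≥ min (a·n^c) (n^κ · Q (n-1))` ("either no violator at exponent `c`, or a violator fibres over
`S_{n-1}` with gain `n^κ`"), and `Q ≥ 1` always.  Conclusion: `a·n^c ≤ Q n` eventually.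

Proof.
* One-step growth of a real power: `(x+1)^c ≤ M₀ · x^c` for `x ≥ 1`, `M₀ := max 1 (2^c)`
  (`rpow_succ_le_max_mul_rpow`).
* Threshold: `M₀ ≤ n^κ` for all large `n` (`tendsto_rpow_atTop`), say for `n ≥ N`; put
  `n₂ := max n₁ (max N 1)`.
* Propagation: for `n ≥ n₂`, if `a·n^c ≤ Q n` then `a·(n+1)^c ≤ Q (n+1)`, because both entries of
  the `min` at `n+1` dominate `a·(n+1)^c ≤ M₀·a·n^c ≤ (n+1)^κ · Q n`.  Hence one good index
  `≥ n₂` makes every later index good (`Nat.le_induction`).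
* Existence of a good index, by contradiction: if every `n ≥ n₂` is bad then the `min` is never
  its first entry, so `Q (n+1) ≥ (n+1)^κ Q n ≥ 2^κ Q n`, whence `Q n ≥ r^(n-n₂)` with
  `r := 2^κ > 1`; but `a·n^c ≤ a·n^⌈c⌉₊` and `n^⌈c⌉₊ / r^n → 0`
  (`tendsto_pow_const_div_const_pow_of_one_lt`), contradicting `r^(n-n₂) ≤ Q n < a·n^c`.
-/

namespace Summit.MatrixMultiplication.MatrixMultiplication.Theorems.PolynomialSlack

-- `Summit.<Summit>.<Problem>` is the tree's mandated summit-side namespace; for this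
-- single-conjunct summit the two coincide, so the file silences `dupNamespace`.
set_option linter.dupNamespace false

open Filter Topology

/-- One-step growth of a real power along `x ≥ 1`: for any real exponent `c`,
`(x + 1) ^ c ≤ max 1 (2 ^ c) * x ^ c` (for `0 ≤ c` use `x + 1 ≤ 2x` and `Real.mul_rpow`; for
`c < 0` the power is antitone in the base, `Real.rpow_le_rpow_of_nonpos`). [folklore] -/
theorem rpow_succ_le_max_mul_rpow (x c : ℝ) (hx : 1 ≤ x) :
    (x + 1) ^ c ≤ max 1 ((2 : ℝ) ^ c) * x ^ c := by
  have hx0 : 0 < x := one_pos.trans_le hx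
  have hxc : 0 ≤ x ^ c := Real.rpow_nonneg hx0.le c
  rcases le_or_gt 0 c with hc | hc
  · calc (x + 1) ^ c ≤ (2 * x) ^ c := Real.rpow_le_rpow (by positivity) (by linarith) hc
      _ = (2 : ℝ) ^ c * x ^ c := Real.mul_rpow (by norm_num) hx0.le
      _ ≤ max 1 ((2 : ℝ) ^ c) * x ^ c := mul_le_mul_of_nonneg_right (le_max_right _ _) hxc
  · calc (x + 1) ^ c ≤ x ^ c := Real.rpow_le_rpow_of_nonpos hx0 (by linarith) hc.le
      _ = 1 * x ^ c := (one_mul _).symm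
      _ ≤ max 1 ((2 : ℝ) ^ c) * x ^ c := mul_le_mul_of_nonneg_right (le_max_left _ _) hxc

-- adapted from reserve/prior-2001/Prior/Parity/GeneralizedHardyLittlewood/Gb_ConverseHypothesesSpine_GbPCCore.lean (eventually_rpow_ge)
/-- `M ≤ n ^ κ` for all large naturals `n`, for a positive real exponent `κ`
(`tendsto_rpow_atTop` along `Nat.cast`). [folklore] -/
theorem eventually_le_natCast_rpow (κ M : ℝ) (hκ : 0 < κ) :
    ∀ᶠ n : ℕ in atTop, M ≤ (n : ℝ) ^ κ :=
  ((tendsto_rpow_atTop hκ).comp tendsto_natCast_atTop_atTop).eventually_ge_atTop M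

/-- **Eventual polynomial lower bound from a `min`-recursion** (registered stub
`eventually_le_of_min_le` of line `transport-split-hull`).  If `Q ≥ 1` and, for `n ≥ n₁`,
`min (a·n^c) (n^κ · Q (n-1)) ≤ Q n` with `a, κ > 0`, then `a·n^c ≤ Q n` for all large `n`.
Propagation (`a·(n+1)^c ≤ max 1 (2^c) · a·n^c ≤ (n+1)^κ · Q n` once `(n+1)^κ ≥ max 1 (2^c)`)
plus existence of one good index by contradiction (otherwise `Q n ≥ (2^κ)^(n-n₂)` grows
exponentially while `Q n < a·n^c ≤ a·n^⌈c⌉₊`, against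
`tendsto_pow_const_div_const_pow_of_one_lt`). [folklore] -/
theorem eventually_le_of_min_le (Q : ℕ → ℝ) (a c κ : ℝ) (ha : 0 < a) (hκ : 0 < κ) (n₁ : ℕ)
    (hQ : ∀ n, 1 ≤ Q n)
    (hstep : ∀ n : ℕ, n₁ ≤ n → min (a * (n : ℝ) ^ c) ((n : ℝ) ^ κ * Q (n - 1)) ≤ Q n) :
    ∃ n₀ : ℕ, ∀ n : ℕ, n₀ ≤ n → a * (n : ℝ) ^ c ≤ Q n := by
  -- the one-step growth constant `M₀ = max 1 (2 ^ c)`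
  obtain ⟨M₀, hM₀⟩ : ∃ M₀ : ℝ, ∀ x : ℝ, 1 ≤ x → (x + 1) ^ c ≤ M₀ * x ^ c :=
    ⟨_, fun x hx => rpow_succ_le_max_mul_rpow x c hx⟩
  -- (1) the threshold: `M₀ ≤ n ^ κ` for `n ≥ N`
  obtain ⟨N, hN⟩ := eventually_atTop.1 (eventually_le_natCast_rpow κ M₀ hκ)
  obtain ⟨n₂, hn₂₁, hn₂N, hn₂one⟩ : ∃ n₂ : ℕ, n₁ ≤ n₂ ∧ N ≤ n₂ ∧ 1 ≤ n₂ :=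
    ⟨max n₁ (max N 1), le_max_left _ _, (le_max_left _ _).trans (le_max_right _ _),
      (le_max_right _ _).trans (le_max_right _ _)⟩
  -- (2) propagation: for `n ≥ n₂`, a good `n` gives a good `n + 1`
  have hprop : ∀ n : ℕ, n₂ ≤ n → a * (n : ℝ) ^ c ≤ Q n →
      a * ((n + 1 : ℕ) : ℝ) ^ c ≤ Q (n + 1) := by
    intro n hn hgood
    have h1 := hstep (n + 1) (by omega)
    simp only [Nat.add_sub_cancel] at h1
    rcases min_le_iff.1 h1 with h | h
    · exact h
    · have hxn : (1 : ℝ) ≤ n := by exact_mod_cast hn₂one.trans hn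
      have hM : M₀ ≤ ((n + 1 : ℕ) : ℝ) ^ κ := hN (n + 1) (by omega)
      have hgrow : ((n + 1 : ℕ) : ℝ) ^ c ≤ M₀ * (n : ℝ) ^ c := by
        push_cast
        exact hM₀ (n : ℝ) hxn
      have hnc : 0 ≤ a * (n : ℝ) ^ c := mul_nonneg ha.le (Real.rpow_nonneg (Nat.cast_nonneg n) c)
      calc a * ((n + 1 : ℕ) : ℝ) ^ c ≤ a * (M₀ * (n : ℝ) ^ c) :=
            mul_le_mul_of_nonneg_left hgrow ha.le
        _ = M₀ * (a * (n : ℝ) ^ c) := by ring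
        _ ≤ ((n + 1 : ℕ) : ℝ) ^ κ * Q n :=
            mul_le_mul hM hgood hnc (Real.rpow_nonneg (Nat.cast_nonneg _) κ)
        _ ≤ Q (n + 1) := h
  -- hence once some `m ≥ n₂` is good, every `n ≥ m` is good
  have hall : ∀ m : ℕ, n₂ ≤ m → a * (m : ℝ) ^ c ≤ Q m →
      ∀ n : ℕ, m ≤ n → a * (n : ℝ) ^ c ≤ Q n := by
    intro m hm hgood n hmn
    induction n, hmn using Nat.le_induction with
    | base => exact hgood
    | succ n hmn ih => exact hprop n (hm.trans hmn) ih
  -- (3) existence of a good index `≥ n₂`, by contradiction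
  by_contra hcon
  have hbad : ∀ n : ℕ, n₂ ≤ n → Q n < a * (n : ℝ) ^ c := by
    intro n hn
    by_contra h
    exact hcon ⟨n, hall n hn (not_lt.1 h)⟩
  -- exponential growth of `Q` along the bad range, ratio `r = 2 ^ κ > 1`
  obtain ⟨r, hr1, hrle⟩ : ∃ r : ℝ, 1 < r ∧ ∀ n : ℕ, 2 ≤ n → r ≤ (n : ℝ) ^ κ := by
    refine ⟨(2 : ℝ) ^ κ, Real.one_lt_rpow (by norm_num) hκ, fun n hn => ?_⟩
    exact Real.rpow_le_rpow (by norm_num) (by exact_mod_cast hn) hκ.le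
  have hr0 : 0 < r := one_pos.trans hr1
  have hexp : ∀ n : ℕ, n₂ ≤ n → r ^ (n - n₂) ≤ Q n := by
    intro n hn
    induction n, hn using Nat.le_induction with
    | base => simpa using hQ n₂
    | succ n hn ih =>
      have h1 := hstep (n + 1) (by omega)
      simp only [Nat.add_sub_cancel] at h1
      have h2 : ((n + 1 : ℕ) : ℝ) ^ κ * Q n ≤ Q (n + 1) := by
        rcases min_le_iff.1 h1 with h | h
        · exact absurd h (not_le.2 (hbad (n + 1) (by omega)))
        · exact h
      have h3 : r ≤ ((n + 1 : ℕ) : ℝ) ^ κ := hrle (n + 1) (by omega)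
      have h4 : n + 1 - n₂ = (n - n₂) + 1 := by omega
      calc r ^ (n + 1 - n₂) = r * r ^ (n - n₂) := by rw [h4, pow_succ, mul_comm]
        _ ≤ ((n + 1 : ℕ) : ℝ) ^ κ * Q n :=
            mul_le_mul h3 ih (pow_nonneg hr0.le _) (Real.rpow_nonneg (Nat.cast_nonneg _) κ)
        _ ≤ Q (n + 1) := h2
  -- polynomial bound `n ^ c ≤ n ^ K` for `n ≥ 1`, with `K = ⌈c⌉₊`
  obtain ⟨K, hK⟩ : ∃ K : ℕ, c ≤ (K : ℝ) := ⟨⌈c⌉₊, Nat.le_ceil c⟩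
  have hpoly : ∀ n : ℕ, 1 ≤ n → (n : ℝ) ^ c ≤ (n : ℝ) ^ K := by
    intro n hn
    have hn' : (1 : ℝ) ≤ n := by exact_mod_cast hn
    calc (n : ℝ) ^ c ≤ (n : ℝ) ^ (K : ℝ) := Real.rpow_le_rpow_of_exponent_le hn' hK
      _ = (n : ℝ) ^ K := Real.rpow_natCast _ K
  -- exponential beats polynomial: pick `n ≥ n₂` with `n ^ K / r ^ n < 1 / (a * r ^ n₂)`
  have hlim : Tendsto (fun n : ℕ => (n : ℝ) ^ K / r ^ n) atTop (𝓝 0) :=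
    tendsto_pow_const_div_const_pow_of_one_lt K hr1
  have hε : (0 : ℝ) < 1 / (a * r ^ n₂) := by positivity
  obtain ⟨n, hnlt, hn⟩ :=
    ((hlim.eventually (eventually_lt_nhds hε)).and (eventually_ge_atTop n₂)).exists
  have hrn : 0 < r ^ n := pow_pos hr0 n
  rw [div_lt_div_iff₀ hrn (by positivity), one_mul] at hnlt
  -- `hnlt : n ^ K * (a * r ^ n₂) < r ^ n`, against `r ^ n = r ^ (n - n₂) * r ^ n₂ < a n^K r^n₂`
  have hQn : Q n < a * (n : ℝ) ^ K :=
    (hbad n hn).trans_le (mul_le_mul_of_nonneg_left (hpoly n (hn₂one.trans hn)) ha.le)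
  have hsplit : r ^ n = r ^ (n - n₂) * r ^ n₂ := by
    rw [← pow_add, Nat.sub_add_cancel hn]
  have hlt : r ^ n < (n : ℝ) ^ K * (a * r ^ n₂) := by
    calc r ^ n = r ^ (n - n₂) * r ^ n₂ := hsplit
      _ < a * (n : ℝ) ^ K * r ^ n₂ := mul_lt_mul_of_pos_right ((hexp n hn).trans_lt hQn) (pow_pos hr0 _)
      _ = (n : ℝ) ^ K * (a * r ^ n₂) := by ring
  exact absurd (hnlt.trans hlt) (lt_irrefl _)

end Summit.MatrixMultiplication.MatrixMultiplication.Theorems.PolynomialSlack
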